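import Summits.CriticalPhenomena.PercolationContinuityZ3.Theorems.PercNearOneGluingNoHeavyLowerTailSunflowerCloneTransfer
import Summits.CriticalPhenomena.PercolationContinuityZ3.Theorems.PercNearOneGluingNoHeavyLowerTailSunflowerCloneLaw
import Summits.CriticalPhenomena.PercolationContinuityZ3.Theorems.PercNearOneGluingNoHeavyLowerTailSunflowerPartitionLemma
import Summits.CriticalPhenomena.PercolationContinuityZ3.Theorems.PercNearOneGluingNoHeavyLowerTailCubicThreePointHqtInduction
import HarnessLib

/-!
# `NoHeavyLowerTail` (crux stmt-CriticalPhenomena-4575): the PARTITION LEMMA implies `H_{q+t} ≥ 0` on every finite weighted graph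
# (clone calculus, part 4: the kernel `s6H` and the percolation three-point sunflower)

Support file (seat `prim-l12-p2` gen 6; `--supports stmt-CriticalPhenomena-4575`).  No `sorry`, no named facts; the only hypothesis is prim-ineq-prove-1's
typed conjecture `PartitionLemmaH` (`…SunflowerPartitionLemma`, an obligation of the programme, never a fact).
Memo: run/shared/lean/prim/prim-l12/prim-l12-p2/FINDING-g6-COMPOSITION-IDENTITY.md.

* `Zk_s6H_eq_ZH` — the clone-calculus partition functional with kernel `s6H` IS prove-1's `Sunflower.ZH` (ordered 3-partitions as all-singleton
  pattern assignments); hence `PartitionLemmaH` supplies the hypothesis of the transfer theorem `Mk_bern_nonneg_of_Zk_nonneg`.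
* `sum_s6H_mass_eq` — the cubic form `Σ_{x,y,z} m_x m_y m_z s6H x y z = 6·H_{q+t}(m₀, m₃, m₂, m₁, m₄)` (the tree's `Hqt q u₁ u₂ u₃ t`).
* `connSunflower a b c` — the percolation three-point sunflower `{j ~ k}_i` on the edge cube `2^{Sym2 V}` (up-sets `b~c`, `a~c`, `a~b`; kernel = all
  joined; petals = exactly one pair joined; bottom = `a|b|c`); its cell masses are the finitary cells `PrW univ p (evT/evU₃/evU₂/evU₁/evQ ∅ a b c)` of
  `…CubicThreePointSections` (`mass_connSunflower_*`).
* **`hqt_of_partitionLemmaH`** — `PartitionLemmaH → 0 ≤ H_{q+t}` at the five cells, for every finite `V`, all edge weights `p ∈ [0,1]`, all terminals;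
  **`prodBernoulli_hqt_nonneg_of_partitionLemmaH`** — the same in the tree's percolation vocabulary (`prodBernoulli`, `openConn`), cf. the conditional
  `CubicThreePointStep.prodBernoulli_hqt_nonneg_of_stepHypH` (prim-facecert) whose hypothesis `StepHypH` (the apex Bernstein step) is thereby traded for
  the single counting statement `PartitionLemmaH`.
So the last open cubic three-point row `H_{q+t}` (and with it AG⁺, `T_inc`, 3PT-LB anew) is formally reduced to prove-1's partition lemma; the same transfer
gives `γ`/`G₄` from the pairing sunflower (not instantiated here).
-/

namespace Summit.CriticalPhenomena.PercolationContinuityZ3.Theorems.SunflowerPartition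

open Finset

/-! ### The kernel `s6H` in the clone calculus -/

/-- The real-valued `s6H`. [this work] -/
def s6Hr : Fin 5 → Fin 5 → Fin 5 → ℝ := fun x y z => (s6H x y z : ℝ)

/-- The value table of `s6H`. [this work] -/
theorem s6H_table : ∀ x y z : Fin 5, s6H x y z =
    (![![![0, 0, 0, 0, 2], ![0, 0, -1, -1, 0], ![0, -1, 0, -1, 0], ![0, -1, -1, 0, 0], ![2, 0, 0, 0, 2]],
      ![![0, 0, -1, -1, 0], ![0, 0, 0, 0, 0], ![-1, 0, 0, -1, -1], ![-1, 0, -1, 0, -1], ![0, 0, -1, -1, 0]],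
      ![![0, -1, 0, -1, 0], ![-1, 0, 0, -1, -1], ![0, 0, 0, 0, 0], ![-1, -1, 0, 0, -1], ![0, -1, 0, -1, 0]],
      ![![0, -1, -1, 0, 0], ![-1, 0, -1, 0, -1], ![-1, -1, 0, 0, -1], ![0, 0, 0, 0, 0], ![0, -1, -1, 0, 0]],
      ![![2, 0, 0, 0, 2], ![0, 0, -1, -1, 0], ![0, -1, 0, -1, 0], ![0, -1, -1, 0, 0], ![2, 0, 0, 0, 0]]] :
      Fin 5 → Fin 5 → Fin 5 → ℤ) x y z := by
  decide

/-- **The cubic form of `s6H` is `6·H_{q+t}`** (labels: `0` bottom = `a|b|c`, `4` top = `abc`, petals `1,2,3` = `bc|a, ac|b, ab|c`). [this work] -/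
theorem sum_s6H_mass_eq (m : Fin 5 → ℝ) :
    ∑ x : Fin 5, ∑ y : Fin 5, ∑ z : Fin 5, m x * m y * m z * s6Hr x y z =
      6 * CubicThreePointTerminal.Hqt (m 0) (m 3) (m 2) (m 1) (m 4) := by
  simp only [s6Hr, s6H_table, Fin.sum_univ_five]
  simp only [Matrix.cons_val_zero, Matrix.cons_val_one, Matrix.cons_val]
  norm_num [CubicThreePointTerminal.Hqt]
  ring

section Partition

variable {E : Type*} [Fintype E] [DecidableEq E]

omit [DecidableEq E] in
/-- The product of the `cl1` weights is the indicator of "every coordinate in exactly one copy". [this work] -/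
theorem prod_cl1_eq (β : E → Pat) : ∏ e, cl1 (β e) = if ∀ e, (β e).isSingle = true then 1 else 0 := by
  unfold cl1
  rw [prod_boole]
  simp

/-- For an all-singleton pattern assignment, copy `2` is the complement of copies `0` and `1`, which are disjoint. [this work] -/
theorem blocks_two_eq_of_single {β : E → Pat} (h : ∀ e, (β e).isSingle = true) :
    blocks β 2 = (blocks β 0 ∪ blocks β 1)ᶜ ∧ Disjoint (blocks β 0) (blocks β 1) := by
  constructor
  · ext e
    have he := h e
    simp only [mem_compl, mem_union, mem_blocks, Pat.bit_zero, Pat.bit_one, Pat.bit_two]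
    revert he
    rcases β e with ⟨_ | _, _ | _, _ | _⟩ <;> simp [Pat.isSingle]
  · rw [Finset.disjoint_left]
    intro e h0 h1
    have he := h e
    rw [mem_blocks] at h0 h1
    revert he h0 h1
    rcases β e with ⟨_ | _, _ | _, _ | _⟩ <;> simp [Pat.isSingle]

/-- **The clone-calculus partition functional with kernel `s6H` is `Sunflower.ZH`.** [this work] -/
theorem Zk_s6H_eq_ZH (F : Sunflower E) : Zk s6Hr F.lab = (F.ZH : ℝ) := by
  unfold Zk Mk Sunflower.ZH
  simp_rw [prod_cl1_eq, ite_mul, one_mul, zero_mul]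
  rw [← sum_filter, Int.cast_sum]
  refine sum_nbij' (fun β => (blocks β 0, blocks β 1))
    (fun q => fun e => (decide (e ∈ q.1), decide (e ∈ q.2), decide (e ∉ q.1 ∧ e ∉ q.2))) ?_ ?_ ?_ ?_ ?_
  · intro β hβ
    rw [mem_filter] at hβ
    unfold parts
    rw [mem_filter]
    exact ⟨mem_univ _, (blocks_two_eq_of_single hβ.2).2⟩
  · intro q hq
    unfold parts at hq
    rw [mem_filter] at hq
    rw [mem_filter]
    refine ⟨mem_univ _, fun e => ?_⟩
    have hd := hq.2
    rw [Finset.disjoint_left] at hd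
    by_cases h1 : e ∈ q.1
    · have h2 : e ∉ q.2 := hd h1
      simp [h1, h2, Pat.isSingle]
    · by_cases h2 : e ∈ q.2 <;> simp [h1, h2, Pat.isSingle]
  · intro β hβ
    rw [mem_filter] at hβ
    funext e
    have he := hβ.2 e
    have : (β e).2.2 = (!(β e).1 && !(β e).2.1) := by
      revert he; rcases β e with ⟨_ | _, _ | _, _ | _⟩ <;> simp [Pat.isSingle]
    ext <;> simp [this]
  · intro q hq
    ext e <;> simp [Pat.bit]
  · intro β hβ
    rw [mem_filter] at hβ
    obtain ⟨h2, _⟩ := blocks_two_eq_of_single hβ.2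
    simp only [s6Hr, h2]

/-- `PartitionLemmaH` supplies the hypothesis of the transfer theorem for the kernel `s6H`. [this work] -/
theorem Zk_s6H_nonneg_of_partitionLemmaH (h : PartitionLemmaH) (E : Type) [Fintype E] [DecidableEq E] (F : Sunflower E) :
    0 ≤ Zk s6Hr F.lab := by
  rw [Zk_s6H_eq_ZH]
  exact_mod_cast h E F

/-- **Law-level `H` from the partition lemma, every sunflower, every product measure**:
`0 ≤ 6·H(m₀,m₃,m₂,m₁,m₄)` for the cell masses of any sunflower of up-sets under any `p ∈ [0,1]^E`. [this work] -/
theorem hqt_mass_nonneg_of_partitionLemmaH (h : PartitionLemmaH) (F : Sunflower E) (p : E → ℝ) (hp : ∀ x, 0 ≤ p x ∧ p x ≤ 1) :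
    0 ≤ CubicThreePointTerminal.Hqt (mass F.lab p 0) (mass F.lab p 3) (mass F.lab p 2) (mass F.lab p 1) (mass F.lab p 4) := by
  have h6 := Mk_bern_nonneg_of_Zk_nonneg s6Hr (Zk_s6H_nonneg_of_partitionLemmaH h) F p hp
  rw [Mk_bern_eq_cubic, sum_s6H_mass_eq] at h6
  linarith

end Partition

/-! ### The percolation three-point sunflower `{j ~ k}_i` -/

section Percolation

open CubicThreePointStep CubicThreePointTerminal Literature.Probability.Percolation.DecisionTree

variable {V : Type*} [DecidableEq V] [Fintype V] (a b c : V)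

open scoped Classical in
/-- The three-point CONNECTION SUNFLOWER on the edge cube: up-sets `b~c`, `a~c`, `a~b` (open-edge order); all pairwise intersections are
"`a, b, c` all joined". [this work] -/
noncomputable def connSunflower : Sunflower (Sym2 V) where
  V i := (univ : Finset (Finset (Sym2 V))).filter fun S =>
    if i = 0 then R ∅ S b c else if i = 1 then R ∅ S a c else R ∅ S a b
  upper i := by
    intro S T hST hS
    simp only [coe_filter, mem_univ, true_and, Set.mem_setOf_eq] at hS ⊢
    fin_cases i <;> simp at hS ⊢ <;> exact R_mono_config hST hS
  inter_eq i j hij := by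
    ext S
    have t01 : R ∅ S b c → R ∅ S a c → R ∅ S a b := fun h0 h1 => h1.trans h0.symm
    have t02 : R ∅ S b c → R ∅ S a b → R ∅ S a c := fun h0 h2 => h2.trans h0
    have t12 : R ∅ S a c → R ∅ S a b → R ∅ S b c := fun h1 h2 => h2.symm.trans h1
    simp only [mem_inter, mem_filter, mem_univ, true_and]
    fin_cases i <;> fin_cases j <;> simp at hij ⊢ <;> tauto

/-- Membership in the three up-sets of `connSunflower`. [this work] -/
theorem mem_connSunflower_V (S : Finset (Sym2 V)) :
    (S ∈ (connSunflower a b c).V 0 ↔ R ∅ S b c) ∧ (S ∈ (connSunflower a b c).V 1 ↔ R ∅ S a c) ∧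
      (S ∈ (connSunflower a b c).V 2 ↔ R ∅ S a b) := by
  refine ⟨?_, ?_, ?_⟩ <;> simp [connSunflower]

/-- The label of a set in terms of membership in the three up-sets (pure case analysis of `Sunflower.lab`). [this work] -/
theorem Sunflower.lab_cases {α : Type*} [DecidableEq α] (F : Sunflower α) (S : Finset α) :
    (F.lab S = 4 ↔ S ∈ F.V 0 ∧ S ∈ F.V 1) ∧ (F.lab S = 0 ↔ S ∉ F.V 0 ∧ S ∉ F.V 1 ∧ S ∉ F.V 2) ∧
    (F.lab S = 1 ↔ S ∈ F.V 0 ∧ S ∉ F.V 1) ∧ (F.lab S = 2 ↔ S ∈ F.V 1 ∧ S ∉ F.V 0) ∧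
    (F.lab S = 3 ↔ S ∈ F.V 2 ∧ S ∉ F.V 0 ∧ S ∉ F.V 1) := by
  have hA : S ∈ F.A ↔ S ∈ F.V 0 ∧ S ∈ F.V 1 := by unfold Sunflower.A; rw [mem_inter]
  unfold Sunflower.lab
  refine ⟨?_, ?_, ?_, ?_, ?_⟩ <;> split_ifs <;> norm_num <;> tauto

/-- Propositional bookkeeping: with "any two of the three connections imply the third", the label cells are the three-point cells. [this work] -/
theorem three_conn_logic {P0 P1 P2 L4 L0 L1 L2 L3 : Prop} (t01 : P0 → P1 → P2) (t02 : P0 → P2 → P1) (t12 : P1 → P2 → P0)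
    (c4 : L4 ↔ P0 ∧ P1) (c0 : L0 ↔ ¬P0 ∧ ¬P1 ∧ ¬P2) (c1 : L1 ↔ P0 ∧ ¬P1) (c2 : L2 ↔ P1 ∧ ¬P0) (c3 : L3 ↔ P2 ∧ ¬P0 ∧ ¬P1) :
    (L4 ↔ P2 ∧ P1) ∧ (L0 ↔ ¬P2 ∧ ¬P1 ∧ ¬P0) ∧ (L1 ↔ P0 ∧ ¬P2) ∧ (L2 ↔ P1 ∧ ¬P2) ∧ (L3 ↔ P2 ∧ ¬P1) := by
  refine ⟨?_, ?_, ?_, ?_, ?_⟩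
  · rw [c4]; exact ⟨fun ⟨h0, h1⟩ => ⟨t01 h0 h1, h1⟩, fun ⟨h2, h1⟩ => ⟨t12 h1 h2, h1⟩⟩
  · rw [c0]; exact ⟨fun ⟨h0, h1, h2⟩ => ⟨h2, h1, h0⟩, fun ⟨h2, h1, h0⟩ => ⟨h0, h1, h2⟩⟩
  · rw [c1]; exact ⟨fun ⟨h0, h1⟩ => ⟨h0, fun h2 => h1 (t02 h0 h2)⟩, fun ⟨h0, h2⟩ => ⟨h0, fun h1 => h2 (t01 h0 h1)⟩⟩
  · rw [c2]; exact ⟨fun ⟨h1, h0⟩ => ⟨h1, fun h2 => h0 (t12 h1 h2)⟩, fun ⟨h1, h2⟩ => ⟨h1, fun h0 => h2 (t01 h0 h1)⟩⟩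
  · rw [c3]; exact ⟨fun ⟨h2, _, h1⟩ => ⟨h2, h1⟩, fun ⟨h2, h1⟩ => ⟨h2, fun h0 => h1 (t02 h0 h2), h1⟩⟩

/-- The labels of `connSunflower` are the five three-point cells (`4 ↦ abc`, `0 ↦ a|b|c`, `1 ↦ bc|a`, `2 ↦ ac|b`, `3 ↦ ab|c`). [this work] -/
theorem lab_connSunflower (S : Finset (Sym2 V)) :
    ((connSunflower a b c).lab S = 4 ↔ S ∈ evT ∅ a b c) ∧ ((connSunflower a b c).lab S = 0 ↔ S ∈ evQ ∅ a b c) ∧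
    ((connSunflower a b c).lab S = 1 ↔ S ∈ evU₃ ∅ a b c) ∧ ((connSunflower a b c).lab S = 2 ↔ S ∈ evU₂ ∅ a b c) ∧
    ((connSunflower a b c).lab S = 3 ↔ S ∈ evU₁ ∅ a b c) := by
  obtain ⟨m0, m1, m2⟩ := mem_connSunflower_V a b c S
  obtain ⟨c4, c0, c1, c2, c3⟩ := (connSunflower a b c).lab_cases S
  rw [m0, m1] at c4 c1 c2
  rw [m0, m1, m2] at c0 c3
  rw [mem_evT, mem_evQ, mem_evU₃, mem_evU₂, mem_evU₁]
  exact three_conn_logic (fun h0 h1 => h1.trans h0.symm) (fun h0 h2 => h2.trans h0) (fun h1 h2 => h2.symm.trans h1) c4 c0 c1 c2 c3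

open scoped Classical in
/-- `PrW` over all coordinates as an `ite`-sum with the clone-calculus weight `wP`. [folklore] -/
theorem PrW_univ_eq (p : Sym2 V → ℝ) (X : Set (Finset (Sym2 V))) :
    PrW univ p X = ∑ S : Finset (Sym2 V), if S ∈ X then wP p S else 0 := by
  unfold PrW
  rw [powerset_univ]
  refine sum_congr rfl fun S _ => ?_
  rw [Set.indicator_apply]
  rfl

/-- The cell masses of `connSunflower` are the finitary three-point cells. [this work] -/
theorem mass_connSunflower (p : Sym2 V → ℝ) :
    mass (connSunflower a b c).lab p 4 = PrW univ p (evT ∅ a b c) ∧ mass (connSunflower a b c).lab p 0 = PrW univ p (evQ ∅ a b c) ∧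
    mass (connSunflower a b c).lab p 1 = PrW univ p (evU₃ ∅ a b c) ∧ mass (connSunflower a b c).lab p 2 = PrW univ p (evU₂ ∅ a b c) ∧
    mass (connSunflower a b c).lab p 3 = PrW univ p (evU₁ ∅ a b c) := by
  classical
  unfold mass
  refine ⟨?_, ?_, ?_, ?_, ?_⟩ <;> rw [PrW_univ_eq] <;> refine sum_congr rfl fun S _ => ?_
  · simp only [(lab_connSunflower a b c S).1]
  · simp only [(lab_connSunflower a b c S).2.1]
  · simp only [(lab_connSunflower a b c S).2.2.1]
  · simp only [(lab_connSunflower a b c S).2.2.2.1]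
  · simp only [(lab_connSunflower a b c S).2.2.2.2]

/-- **`PartitionLemmaH ⇒ H_{q+t} ≥ 0` on every finite weighted graph** (finitary form: all edges random with weights `p ∈ [0,1]`; weight `1`/`0`
encode forced/absent edges): `(q+t)(qt − e₂(u)) ≥ e₃(u)` at the five three-point cells. [this work] -/
theorem hqt_of_partitionLemmaH (h : PartitionLemmaH) (p : Sym2 V → ℝ) (hp0 : ∀ e, 0 ≤ p e) (hp1 : ∀ e, p e ≤ 1) :
    0 ≤ Hqt (PrW univ p (evQ ∅ a b c)) (PrW univ p (evU₁ ∅ a b c)) (PrW univ p (evU₂ ∅ a b c)) (PrW univ p (evU₃ ∅ a b c))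
      (PrW univ p (evT ∅ a b c)) := by
  have h0 := hqt_mass_nonneg_of_partitionLemmaH h (connSunflower a b c) p fun e => ⟨hp0 e, hp1 e⟩
  obtain ⟨e4, e0, e1, e2, e3⟩ := mass_connSunflower a b c p
  rwa [e4, e0, e1, e2, e3] at h0

/-- **Measure-level form**: under `PartitionLemmaH`, for every finite `V`, every weight `w : Sym2 V → [0,1]` and all terminals `a,b,c`,
`H_{q+t}(μ(a|b|c), μ(ab|c), μ(ac|b), μ(bc|a), μ(abc)) ≥ 0` for `μ = prodBernoulli w` (cf. `CubicThreePointStep.prodBernoulli_hqt_nonneg_of_stepHypH`,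
whose hypothesis `StepHypH` is here replaced by the counting statement `PartitionLemmaH`). [this work] -/
theorem prodBernoulli_hqt_nonneg_of_partitionLemmaH (h : PartitionLemmaH) (w : Sym2 V → unitInterval) :
    0 ≤ Hqt ((Literature.Probability.LatticeModels.prodBernoulli w).real
              ((Literature.Probability.Percolation.openConn a b)ᶜ ∩ (Literature.Probability.Percolation.openConn a c)ᶜ ∩
                (Literature.Probability.Percolation.openConn b c)ᶜ))
      ((Literature.Probability.LatticeModels.prodBernoulli w).real
              (Literature.Probability.Percolation.openConn a b ∩ (Literature.Probability.Percolation.openConn a c)ᶜ))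
      ((Literature.Probability.LatticeModels.prodBernoulli w).real
              (Literature.Probability.Percolation.openConn a c ∩ (Literature.Probability.Percolation.openConn a b)ᶜ))
      ((Literature.Probability.LatticeModels.prodBernoulli w).real
              (Literature.Probability.Percolation.openConn b c ∩ (Literature.Probability.Percolation.openConn a b)ᶜ))
      ((Literature.Probability.LatticeModels.prodBernoulli w).real
              (Literature.Probability.Percolation.openConn a b ∩ Literature.Probability.Percolation.openConn a c)) := by
  rw [TerminalGluing.real_cellQ, TerminalGluing.real_cellU₁, TerminalGluing.real_cellU₂, TerminalGluing.real_cellU₃,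
    TerminalGluing.real_cellT]
  exact hqt_of_partitionLemmaH a b c h _ (fun e => (w e).2.1) (fun e => (w e).2.2)

end Percolation

end Summit.CriticalPhenomena.PercolationContinuityZ3.Theorems.SunflowerPartition
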